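import Summits.Langlands.Langlands.Theorems.PhantomRMYoshidaResiduallyYoshidaLiftingRelSplit
import HarnessLib

/-!
# r1 strategist split certificate (planner-cstrat-stmt-Langlands-13639-r1-0, 2026-08-17)

Independent re-check of the ANCHORED route-level split of crux `ResiduallyYoshidaLifting`
(stmt-Langlands-13639) before `ledger route edit --split … --glue-by …`:

1. the three INLINE children exactly as `children-rel.json` states them (rendered the way the gate
   renders route items: `def <Decl> : Prop := <statement>`) ELABORATE over the route's vocabulary;
2. each is `Iff.rfl` to the landed Theorems-side definition
   (`RelSectorSplit.RelKlingenDensityGeneric`, `YoshidaDivisorSelmerCount.KlingenLimitClassicality`,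
   `RelSectorSplit.RelKlingenDensityCorner`; p150267 / p116982);
3. the `--glue-by` theorem `RelSectorSplit.ResiduallyYoshidaLifting_of_relSubs` (p150267) proves
   `Child₁ → Child₂ → Child₃ → ResiduallyYoshidaLifting` for the INLINE children (assembly proved);
4. exactness `(C₁ ∧ C₂ ∧ C₃) ↔ (crux ∧ KL2)` and `target → C₁ ∧ C₂ ∧ C₃` on the inline children;
5. crux → C₁, crux → C₃ (children 1/3 are consequences of the crux, used toward it); KL2 ← target.

Expected: rc 0, 0 sorry.  The MUST-FAIL probes (child → summit, child → crux) are in `r1_probes_fail.lean`.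
-/

noncomputable section

set_option linter.dupNamespace false
set_option autoImplicit false

namespace Summit.Langlands.Langlands.Theses.PhantomRMYoshida.R1Split

/-- inline child `RelKlingenDensityGeneric` verbatim from children-rel.json -/
def RelKlingenDensityGeneric : Prop :=
  open Literature.NumberTheory.GaloisRepresentations Literature.NumberTheory.Automorphic IsDedekindDomain NumberField in ∀ (p : ℕ) [Fact p.Prime], p ≠ 2 → ∀ (k : Type) [Field k] [CharP k p] [IsAlgClosed k] [TopologicalSpace k] [DiscreteTopology k] (red : Valued.integer (PadicAlgCl p) →+* k) (σ σ' : FramedGaloisRep ℚ k 2) (hcpt : isCompact_glFiniteIntegralLevel 4 ℚ) (ι : PadicAlgCl p ≃+* ℂ) (ρ₀ ρ : FramedGaloisRep ℚ (PadicAlgCl p) 4), let εb : Field.absoluteGaloisGroup ℚ →* (ZMod p)ˣ := (modularCyclotomicCharacter (AlgebraicClosure ℚ) (HasEnoughRootsOfUnity.natCard_rootsOfUnity (AlgebraicClosure ℚ) p)).comp (MulSemiringAction.toRingAut (Field.absoluteGaloisGroup ℚ) (AlgebraicClosure ℚ)); let Aut := fun r : FramedGaloisRep ℚ (PadicAlgCl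 p) 4 => (∃ π : CuspidalAutomorphicRepData 4 ℚ hcpt, π.1.IsLAlgebraic ∧ ∀ᶠ v : HeightOneSpectrum (RingOfIntegers ℚ) in Filter.cofinite, ∃ a : Multiset ℂ, π.1.HasSatakeParamAt v a ∧ r.IsUnramifiedAt v ∧ r.HasFrobCharpolyAt v (arithFrobPolyOfSatake ι v.residueCard 1 a)); let Sh := fun r : FramedGaloisRep ℚ (PadicAlgCl p) 4 => (r.IsSymplecticWithMultiplierFun (fun g => algebraMap ℚ_[p] (PadicAlgCl p) ((((GaloisRep.cyclotomicCharacter ℚ p g)⁻¹ : ℤ_[p]ˣ) : ℤ_[p]) : ℚ_[p])) ∧ (∀ v : HeightOneSpectrum (RingOfIntegers ℚ), ((p : ℕ) : RingOfIntegers ℚ) ∈ v.asIdeal → r.IsGreenbergOrdinaryOfShapeAt v ![0, 0, 1, 1] ∧ r.IsResiduallyDistinguishedAt v ![0, 0, 1, 1]) ∧ (∀ᶠ v : HeightOneSpectrum (RingOfIntegers ℚ) in Filter.cofinite, r.IsUnramifiedAt v ∧ σ.IsUnramifiedAt v ∧ σ'.IsUnramifiedAt v ∧ ∃ (P : Polynomial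 (Valued.integer (PadicAlgCl p))) (P₁ P₂ : Polynomial k), r.HasFrobCharpolyAt v (P.map (Valued.integer (PadicAlgCl p)).subtype) ∧ σ.HasFrobCharpolyAt v P₁ ∧ σ'.HasFrobCharpolyAt v P₂ ∧ P.map red = P₁ * P₂)); let KLim := fun r : FramedGaloisRep ℚ (PadicAlgCl p) 4 => (∃ S : Set (HeightOneSpectrum (RingOfIntegers ℚ)), S.Finite ∧ ∀ n : ℕ, ∃ (r' : FramedGaloisRep ℚ (PadicAlgCl p) 4) (c : ℕ), Aut r' ∧ (c : ZMod ((p - 1) * p ^ n)) = 1 ∧ (∃ ν : Field.absoluteGaloisGroup ℚ → PadicAlgCl p, r'.IsSymplecticWithMultiplierFun ν) ∧ (∀ v : HeightOneSpectrum (RingOfIntegers ℚ), ((p : ℕ) : RingOfIntegers ℚ) ∈ v.asIdeal → r'.IsGreenbergOrdinaryOfShapeAt v ![0, 0, c, c] ∧ r'.IsResiduallyDistinguishedAt v ![0, 0, c, c]) ∧ ∀ v ∉ S, r.IsUnramifiedAt v ∧ r'.IsUnramifiedAt v ∧ ∃ P P' : Polynomial (Valued.integer (PadicAlgCl p)), r.HasFrobCharpolyAt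 v (P.map (Valued.integer (PadicAlgCl p)).subtype) ∧ r'.HasFrobCharpolyAt v (P'.map (Valued.integer (PadicAlgCl p)).subtype) ∧ ∀ i : ℕ, ‖((P.coeff i : Valued.integer (PadicAlgCl p)) : PadicAlgCl p) - ((P'.coeff i : Valued.integer (PadicAlgCl p)) : PadicAlgCl p)‖ ≤ ‖(p : PadicAlgCl p)‖ ^ n); let Gen : Prop := (5 ≤ p ∧ FramedRep.IsAbsolutelyIrreducible (FramedGaloisRep.restrictField (CyclotomicField p ℚ) σ) ∧ FramedRep.IsAbsolutelyIrreducible (FramedGaloisRep.restrictField (CyclotomicField p ℚ) σ') ∧ ¬ ∃ g : GL (Fin 2) k, ∀ x, ∃ c : k, (g * σ x * g⁻¹).val = c • (σ' x).val); σ.toGaloisRep.IsIrreducible → σ'.toGaloisRep.IsIrreducible → (∀ g, FramedRep.det σ g = (Units.map (ZMod.castHom (dvd_refl p) k).toMonoidHom (εb g))⁻¹ ∧ FramedRep.det σ' g = FramedRep.det σ g) → (¬ ∃ g : GL (Fin 2) k, ∀ x, g * σ x * g⁻¹ = σ' x) → Gen → ρ₀.toGaloisRep.IsIrreducible → Sh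 ρ₀ → Aut ρ₀ → ρ.toGaloisRep.IsIrreducible → Sh ρ → KLim ρ

/-- inline child `KlingenLimitClassicality` verbatim from children-rel.json -/
def KlingenLimitClassicality : Prop :=
  open Literature.NumberTheory.GaloisRepresentations Literature.NumberTheory.Automorphic IsDedekindDomain NumberField in ∀ (p : ℕ) [Fact p.Prime], p ≠ 2 → ∀ (k : Type) [Field k] [CharP k p] [IsAlgClosed k] [TopologicalSpace k] [DiscreteTopology k] (red : Valued.integer (PadicAlgCl p) →+* k) (σ σ' : FramedGaloisRep ℚ k 2) (hcpt : isCompact_glFiniteIntegralLevel 4 ℚ) (ι : PadicAlgCl p ≃+* ℂ) (ρ : FramedGaloisRep ℚ (PadicAlgCl p) 4), let εb : Field.absoluteGaloisGroup ℚ →* (ZMod p)ˣ := (modularCyclotomicCharacter (AlgebraicClosure ℚ) (HasEnoughRootsOfUnity.natCard_rootsOfUnity (AlgebraicClosure ℚ) p)).comp (MulSemiringAction.toRingAut (Field.absoluteGaloisGroup ℚ) (AlgebraicClosure ℚ)); let Aut := fun r : FramedGaloisRep ℚ (PadicAlgCl p) 4 => (∃ π : CuspidalAutomorphicRepData 4 ℚ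 hcpt, π.1.IsLAlgebraic ∧ ∀ᶠ v : HeightOneSpectrum (RingOfIntegers ℚ) in Filter.cofinite, ∃ a : Multiset ℂ, π.1.HasSatakeParamAt v a ∧ r.IsUnramifiedAt v ∧ r.HasFrobCharpolyAt v (arithFrobPolyOfSatake ι v.residueCard 1 a)); let Sh := fun r : FramedGaloisRep ℚ (PadicAlgCl p) 4 => (r.IsSymplecticWithMultiplierFun (fun g => algebraMap ℚ_[p] (PadicAlgCl p) ((((GaloisRep.cyclotomicCharacter ℚ p g)⁻¹ : ℤ_[p]ˣ) : ℤ_[p]) : ℚ_[p])) ∧ (∀ v : HeightOneSpectrum (RingOfIntegers ℚ), ((p : ℕ) : RingOfIntegers ℚ) ∈ v.asIdeal → r.IsGreenbergOrdinaryOfShapeAt v ![0, 0, 1, 1] ∧ r.IsResiduallyDistinguishedAt v ![0, 0, 1, 1]) ∧ (∀ᶠ v : HeightOneSpectrum (RingOfIntegers ℚ) in Filter.cofinite, r.IsUnramifiedAt v ∧ σ.IsUnramifiedAt v ∧ σ'.IsUnramifiedAt v ∧ ∃ (P : Polynomial (Valued.integer (PadicAlgCl p))) (P₁ P₂ : Polynomial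 k), r.HasFrobCharpolyAt v (P.map (Valued.integer (PadicAlgCl p)).subtype) ∧ σ.HasFrobCharpolyAt v P₁ ∧ σ'.HasFrobCharpolyAt v P₂ ∧ P.map red = P₁ * P₂)); let KLim := fun r : FramedGaloisRep ℚ (PadicAlgCl p) 4 => (∃ S : Set (HeightOneSpectrum (RingOfIntegers ℚ)), S.Finite ∧ ∀ n : ℕ, ∃ (r' : FramedGaloisRep ℚ (PadicAlgCl p) 4) (c : ℕ), Aut r' ∧ (c : ZMod ((p - 1) * p ^ n)) = 1 ∧ (∃ ν : Field.absoluteGaloisGroup ℚ → PadicAlgCl p, r'.IsSymplecticWithMultiplierFun ν) ∧ (∀ v : HeightOneSpectrum (RingOfIntegers ℚ), ((p : ℕ) : RingOfIntegers ℚ) ∈ v.asIdeal → r'.IsGreenbergOrdinaryOfShapeAt v ![0, 0, c, c] ∧ r'.IsResiduallyDistinguishedAt v ![0, 0, c, c]) ∧ ∀ v ∉ S, r.IsUnramifiedAt v ∧ r'.IsUnramifiedAt v ∧ ∃ P P' : Polynomial (Valued.integer (PadicAlgCl p)), r.HasFrobCharpolyAt v (P.map (Valued.integer (PadicAlgCl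 p)).subtype) ∧ r'.HasFrobCharpolyAt v (P'.map (Valued.integer (PadicAlgCl p)).subtype) ∧ ∀ i : ℕ, ‖((P.coeff i : Valued.integer (PadicAlgCl p)) : PadicAlgCl p) - ((P'.coeff i : Valued.integer (PadicAlgCl p)) : PadicAlgCl p)‖ ≤ ‖(p : PadicAlgCl p)‖ ^ n); σ.toGaloisRep.IsIrreducible → σ'.toGaloisRep.IsIrreducible → (∀ g, FramedRep.det σ g = (Units.map (ZMod.castHom (dvd_refl p) k).toMonoidHom (εb g))⁻¹ ∧ FramedRep.det σ' g = FramedRep.det σ g) → (¬ ∃ g : GL (Fin 2) k, ∀ x, g * σ x * g⁻¹ = σ' x) → ρ.toGaloisRep.IsIrreducible → Sh ρ → KLim ρ → Aut ρ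

/-- inline child `RelKlingenDensityCorner` verbatim from children-rel.json -/
def RelKlingenDensityCorner : Prop :=
  open Literature.NumberTheory.GaloisRepresentations Literature.NumberTheory.Automorphic IsDedekindDomain NumberField in ∀ (p : ℕ) [Fact p.Prime], p ≠ 2 → ∀ (k : Type) [Field k] [CharP k p] [IsAlgClosed k] [TopologicalSpace k] [DiscreteTopology k] (red : Valued.integer (PadicAlgCl p) →+* k) (σ σ' : FramedGaloisRep ℚ k 2) (hcpt : isCompact_glFiniteIntegralLevel 4 ℚ) (ι : PadicAlgCl p ≃+* ℂ) (ρ₀ ρ : FramedGaloisRep ℚ (PadicAlgCl p) 4), let εb : Field.absoluteGaloisGroup ℚ →* (ZMod p)ˣ := (modularCyclotomicCharacter (AlgebraicClosure ℚ) (HasEnoughRootsOfUnity.natCard_rootsOfUnity (AlgebraicClosure ℚ) p)).comp (MulSemiringAction.toRingAut (Field.absoluteGaloisGroup ℚ) (AlgebraicClosure ℚ)); let Aut := fun r : FramedGaloisRep ℚ (PadicAlgCl p) 4 => (∃ π : CuspidalAutomorphicRepData 4 ℚ hcpt, π.1.IsLAlgebraic ∧ ∀ᶠ v : HeightOneSpectrum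 (RingOfIntegers ℚ) in Filter.cofinite, ∃ a : Multiset ℂ, π.1.HasSatakeParamAt v a ∧ r.IsUnramifiedAt v ∧ r.HasFrobCharpolyAt v (arithFrobPolyOfSatake ι v.residueCard 1 a)); let Sh := fun r : FramedGaloisRep ℚ (PadicAlgCl p) 4 => (r.IsSymplecticWithMultiplierFun (fun g => algebraMap ℚ_[p] (PadicAlgCl p) ((((GaloisRep.cyclotomicCharacter ℚ p g)⁻¹ : ℤ_[p]ˣ) : ℤ_[p]) : ℚ_[p])) ∧ (∀ v : HeightOneSpectrum (RingOfIntegers ℚ), ((p : ℕ) : RingOfIntegers ℚ) ∈ v.asIdeal → r.IsGreenbergOrdinaryOfShapeAt v ![0, 0, 1, 1] ∧ r.IsResiduallyDistinguishedAt v ![0, 0, 1, 1]) ∧ (∀ᶠ v : HeightOneSpectrum (RingOfIntegers ℚ) in Filter.cofinite, r.IsUnramifiedAt v ∧ σ.IsUnramifiedAt v ∧ σ'.IsUnramifiedAt v ∧ ∃ (P : Polynomial (Valued.integer (PadicAlgCl p))) (P₁ P₂ : Polynomial k), r.HasFrobCharpolyAt v (P.map (Valued.integer (PadicAlgCl p)).subtype)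 ∧ σ.HasFrobCharpolyAt v P₁ ∧ σ'.HasFrobCharpolyAt v P₂ ∧ P.map red = P₁ * P₂)); let KLim := fun r : FramedGaloisRep ℚ (PadicAlgCl p) 4 => (∃ S : Set (HeightOneSpectrum (RingOfIntegers ℚ)), S.Finite ∧ ∀ n : ℕ, ∃ (r' : FramedGaloisRep ℚ (PadicAlgCl p) 4) (c : ℕ), Aut r' ∧ (c : ZMod ((p - 1) * p ^ n)) = 1 ∧ (∃ ν : Field.absoluteGaloisGroup ℚ → PadicAlgCl p, r'.IsSymplecticWithMultiplierFun ν) ∧ (∀ v : HeightOneSpectrum (RingOfIntegers ℚ), ((p : ℕ) : RingOfIntegers ℚ) ∈ v.asIdeal → r'.IsGreenbergOrdinaryOfShapeAt v ![0, 0, c, c] ∧ r'.IsResiduallyDistinguishedAt v ![0, 0, c, c]) ∧ ∀ v ∉ S, r.IsUnramifiedAt v ∧ r'.IsUnramifiedAt v ∧ ∃ P P' : Polynomial (Valued.integer (PadicAlgCl p)), r.HasFrobCharpolyAt v (P.map (Valued.integer (PadicAlgCl p)).subtype) ∧ r'.HasFrobCharpolyAt v (P'.map (Valued.integer (PadicAlgCl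 p)).subtype) ∧ ∀ i : ℕ, ‖((P.coeff i : Valued.integer (PadicAlgCl p)) : PadicAlgCl p) - ((P'.coeff i : Valued.integer (PadicAlgCl p)) : PadicAlgCl p)‖ ≤ ‖(p : PadicAlgCl p)‖ ^ n); let Gen : Prop := (5 ≤ p ∧ FramedRep.IsAbsolutelyIrreducible (FramedGaloisRep.restrictField (CyclotomicField p ℚ) σ) ∧ FramedRep.IsAbsolutelyIrreducible (FramedGaloisRep.restrictField (CyclotomicField p ℚ) σ') ∧ ¬ ∃ g : GL (Fin 2) k, ∀ x, ∃ c : k, (g * σ x * g⁻¹).val = c • (σ' x).val); σ.toGaloisRep.IsIrreducible → σ'.toGaloisRep.IsIrreducible → (∀ g, FramedRep.det σ g = (Units.map (ZMod.castHom (dvd_refl p) k).toMonoidHom (εb g))⁻¹ ∧ FramedRep.det σ' g = FramedRep.det σ g) → (¬ ∃ g : GL (Fin 2) k, ∀ x, g * σ x * g⁻¹ = σ' x) → ¬ Gen → ρ₀.toGaloisRep.IsIrreducible → Sh ρ₀ → Aut ρ₀ → ρ.toGaloisRep.IsIrreducible → Sh ρ → KLim ρ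

end Summit.Langlands.Langlands.Theses.PhantomRMYoshida.R1Split

namespace Summit.Langlands.Langlands.Theses.PhantomRMYoshida.R1Split
open Summit.Langlands.Langlands.Cruxes.ResiduallyYoshidaLifting

/-! ## 2. inline = landed (Iff.rfl) -/
theorem relKDG_iff : RelKlingenDensityGeneric ↔ RelSectorSplit.RelKlingenDensityGeneric := Iff.rfl
theorem kl2_iff : KlingenLimitClassicality ↔ YoshidaDivisorSelmerCount.KlingenLimitClassicality := Iff.rfl
theorem relKDC_iff : RelKlingenDensityCorner ↔ RelSectorSplit.RelKlingenDensityCorner := Iff.rfl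

/-! ## 3. the assembly (glue-by) on the inline children -/
theorem ResiduallyYoshidaLifting_of_inlineSubs :
    RelKlingenDensityGeneric → KlingenLimitClassicality → RelKlingenDensityCorner →
      Summit.Langlands.Langlands.Theses.PhantomRMYoshida.ResiduallyYoshidaLifting :=
  RelSectorSplit.ResiduallyYoshidaLifting_of_relSubs

/-! ## 4. exactness and target ⇒ children -/
theorem inlineSubs_iff :
    (RelKlingenDensityGeneric ∧ KlingenLimitClassicality ∧ RelKlingenDensityCorner) ↔
      (Summit.Langlands.Langlands.Theses.PhantomRMYoshida.ResiduallyYoshidaLifting ∧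
        YoshidaDivisorSelmerCount.KlingenLimitClassicality) :=
  RelSectorSplit.relSubs_iff

theorem inlineSubs_of_target (h : Summit.Langlands.Langlands.Theses.PhantomRMYoshida.PhantomRMSector) :
    RelKlingenDensityGeneric ∧ KlingenLimitClassicality ∧ RelKlingenDensityCorner :=
  RelSectorSplit.relSubs_of_phantomRMSector h

/-! ## 5. crux ⇒ children 1 and 3; target ⇒ child 2 -/
theorem relKDG_of_crux (h : Summit.Langlands.Langlands.Theses.PhantomRMYoshida.ResiduallyYoshidaLifting) :
    RelKlingenDensityGeneric := RelSectorSplit.relKlingenDensityGeneric_of_crux h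
theorem relKDC_of_crux (h : Summit.Langlands.Langlands.Theses.PhantomRMYoshida.ResiduallyYoshidaLifting) :
    RelKlingenDensityCorner := RelSectorSplit.relKlingenDensityCorner_of_crux h
theorem kl2_of_target (h : Summit.Langlands.Langlands.Theses.PhantomRMYoshida.PhantomRMSector) :
    KlingenLimitClassicality := YoshidaDivisorSelmerCount.klingenLimitClassicality_of_phantomRMSector h

end Summit.Langlands.Langlands.Theses.PhantomRMYoshida.R1Split

end
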